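import Summits.Ventures.Crystal3D.Theorems.StickyWulffConstantNoReconstructionGainInterstitialGain
import HarnessLib

/-!
# Two rungs from the gain bound: the per-ball compensation rule, and bond-orientationally registered films

HONEST FRAMING. Part of the venture `Summits/Ventures/Crystal3D` (cell `crystal3d-full`), helper
`--supports` the crux `NoReconstructionGain` (stmt-Ventures-19144, route
`route-Ventures-StickyWulffConstant`), line `adhesion` (wulff-p1 g10); corollaries of
`interstitialGain_slab` (`…InterstitialGain`).

* `fcc_unit_mem_of_bondStar` — a twelve-element set of unit vectors of `Λ₀` contains EVERY unit
  vector of `Λ₀` (a thirteenth would give thirteen unit balls kissing one: `card_partners_le_twelve`);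
  so the abstract bond star `U` of the gain bound is the bond star, and hypotheses may be stated with
  `∃ d ∈ Λ₀, ‖d‖ = 1, …` instead of `∃ d ∈ U, …`.
* `compensatedFilm_slab` (**rung**, `R = 2`, `C = 780`): the PER-BALL RULE — if off a rim set of at
  most `ρ` film balls every film ball `q` has
  `#{interstitial substrate contacts} + #{interstitial film contacts ν-below q} + ½ #{interstitial
  film contacts ν-level} ≤ #{vacant caps d ∈ U, ⟪d,ν⟫ < 0} + ½ #{vacant caps d ∈ U, ⟪d,ν⟫ = 0}`,
  the atom holds.  This is a certificate in the sense of `…Certificate` (the cap transfer), exact up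
  to the rim by `…InterstitialGain`; it is satisfied ball by ball by fcc continuation (no interstitial
  bonds), by Barlow films at hex-family normals (each twin-type lower bond sits `33.6°` off a vacant
  registered down-slot) and by fully misoriented grains (all down-slots vacant).
* `registeredFilm_slab` (**rung**, `R = 2`, `C = 768`): BOND-ORIENTATIONALLY REGISTERED films — if
  every contact of every film ball (with the substrate or within the film) lies within `30°` of a bond
  direction of the substrate lattice, the atom holds: positions arbitrary (off-lattice allowed),
  coordination arbitrary, every normal.  First every-ν off-lattice class of the line not defined by a
  position lattice or a coordination cap: strained / defective / vacancy-riddled same-orientation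
  continuation of the substrate, at any facet.

WHAT THIS IS NOT: films with many interstitial bonds and few vacant registered slots (hcp-on-prism
facets away from the hex family, amorphous 7-cores) are not covered by the per-ball rule as stated —
the crux; rung F-C1 not moved.
-/

noncomputable section

namespace Summit.Ventures.Crystal3D.Theorems

open Summit.Ventures.Crystal3D Finset
open Literature.MathematicalPhysics.StatisticalMechanics (fccStacking barlowPos constHagg orderedContacts
  contactDeficiency)
open scoped InnerProductSpace

/-- **The bond star is all of the unit shell.**  A twelve-element set of unit vectors of `Λ₀`
contains every unit vector of `Λ₀` (kissing number twelve). -/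
theorem fcc_unit_mem_of_bondStar (U : Finset (EuclideanSpace ℝ (Fin 3)))
    (hU : ∀ d ∈ U, d ∈ fccStacking 1 (Real.sqrt (2 / 3)) ∧ ‖d‖ = 1) (hUcard : U.card = 12)
    {d : EuclideanSpace ℝ (Fin 3)} (hd : d ∈ fccStacking 1 (Real.sqrt (2 / 3))) (hdn : ‖d‖ = 1) :
    d ∈ U := by
  classical
  by_contra hdU
  -- thirteen unit lattice vectors, pairwise `≥ 1` apart, all at distance `1` from the origin
  set V := insert d U with hV
  have hVcard : V.card = 13 := by rw [hV, card_insert_of_notMem hdU, hUcard]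
  have hVmem : ∀ v ∈ V, v ∈ fccStacking 1 (Real.sqrt (2 / 3)) ∧ ‖v‖ = 1 := by
    intro v hv
    rcases mem_insert.1 hv with rfl | hv
    · exact ⟨hd, hdn⟩
    · exact hU v hv
  set X := insert (0 : EuclideanSpace ℝ (Fin 3)) V with hX
  have h0V : (0 : EuclideanSpace ℝ (Fin 3)) ∉ V := by
    intro h0
    have := (hVmem 0 h0).2
    rw [norm_zero] at this; exact zero_ne_one this
  have hsepV : ∀ v ∈ V, ∀ w ∈ V, v ≠ w → 1 ≤ dist v w := by
    intro v hv w hw hvw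
    have h := real_inner_le_half_of_fcc_unit (hVmem v hv).1 (hVmem w hw).1 (hVmem v hv).2 (hVmem w hw).2 hvw
    have h2 : dist v w ^ 2 = 2 - 2 * ⟪v, w⟫_ℝ := by
      rw [dist_eq_norm, norm_sub_sq_real, (hVmem v hv).2, (hVmem w hw).2]; ring
    nlinarith [dist_nonneg (x := v) (y := w)]
  have hXpack : ∀ p ∈ X, ∀ q ∈ X, p ≠ q → 1 ≤ dist p q := by
    intro p hp q hq hpq
    rcases mem_insert.1 hp with rfl | hp
    · rcases mem_insert.1 hq with rfl | hq
      · exact absurd rfl hpq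
      · rw [dist_eq_norm, zero_sub, norm_neg, (hVmem q hq).2]
    · rcases mem_insert.1 hq with rfl | hq
      · rw [dist_eq_norm, sub_zero, (hVmem p hp).2]
      · exact hsepV p hp q hq hpq
  have h12 := card_partners_le_twelve X hXpack 0
  have hsub : V ⊆ X.filter fun x => dist (0 : EuclideanSpace ℝ (Fin 3)) x = 1 := by
    intro v hv
    refine mem_filter.2 ⟨mem_insert_of_mem hv, ?_⟩
    rw [dist_eq_norm, zero_sub, norm_neg, (hVmem v hv).2]
  have := card_le_card hsub
  omega

/-- **The per-ball compensation rule implies the atom** (`R = 2`, `C = 780`; registered by name on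
stmt-Ventures-19144).  `U` is any twelve-element set of unit vectors of `Λ₀` closed under negation
(= the bond star, `fcc_unit_mem_of_bondStar`). -/
theorem compensatedFilm_slab :
    ∃ R C : ℝ, 1 ≤ R ∧ ∀ U : Finset (EuclideanSpace ℝ (Fin 3)),
      (∀ d ∈ U, d ∈ fccStacking 1 (Real.sqrt (2 / 3)) ∧ ‖d‖ = 1) → (∀ d ∈ U, -d ∈ U) → U.card = 12 →
      ∀ ν : EuclideanSpace ℝ (Fin 3), ‖ν‖ = 1 → ∀ ρ : ℝ, R ≤ ρ →
      ∀ X P : Finset (EuclideanSpace ℝ (Fin 3)),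
      (∀ p ∈ X, ∀ q ∈ X, p ≠ q → 1 ≤ dist p q) → P ⊆ X →
      (∀ p, p ∈ P ↔ (p ∈ fccStacking 1 (Real.sqrt (2 / 3)) ∧ -(2 * R) ≤ ⟪p, ν⟫_ℝ ∧
        ⟪p, ν⟫_ℝ ≤ -R ∧ ‖p‖ ^ 2 - ⟪p, ν⟫_ℝ ^ 2 ≤ ρ ^ 2)) →
      (∀ q ∈ X \ P, -R < ⟪q, ν⟫_ℝ) →
      (∃ E : Finset (EuclideanSpace ℝ (Fin 3)), E ⊆ X \ P ∧ (E.card : ℝ) ≤ ρ ∧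
        ∀ q ∈ (X \ P) \ E,
          ((P.filter fun p => dist q p = 1 ∧ ∀ d ∈ U, ⟪p - q, d⟫_ℝ ≤ Real.sqrt 3 / 2).card : ℝ)
            + (((X \ P).filter fun x => dist q x = 1 ∧ (∀ d ∈ U, ⟪x - q, d⟫_ℝ ≤ Real.sqrt 3 / 2) ∧
                ⟪x, ν⟫_ℝ < ⟪q, ν⟫_ℝ).card : ℝ)
            + (1 / 2) * (((X \ P).filter fun x => dist q x = 1 ∧ (∀ d ∈ U, ⟪x - q, d⟫_ℝ ≤ Real.sqrt 3 / 2) ∧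
                ⟪x, ν⟫_ℝ = ⟪q, ν⟫_ℝ).card : ℝ)
          ≤ ((U.filter fun d => ⟪d, ν⟫_ℝ < 0 ∧
                ∀ x ∈ X, dist q x = 1 → ⟪x - q, d⟫_ℝ ≤ Real.sqrt 3 / 2).card : ℝ)
            + (1 / 2) * ((U.filter fun d => ⟪d, ν⟫_ℝ = 0 ∧
                ∀ x ∈ X, dist q x = 1 → ⟪x - q, d⟫_ℝ ≤ Real.sqrt 3 / 2).card : ℝ)) →
      ((((P ×ˢ (X \ P)).filter fun pq => dist pq.1 pq.2 = 1).card : ℕ) : ℝ) ≤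
        contactDeficiency (X \ P) + C * ρ := by
  classical
  obtain ⟨R, C, hR, hA⟩ := interstitialGain_slab
  refine ⟨R, C + 12, hR, ?_⟩
  intro U hU hUneg hUcard ν hν ρ hρ X P hX hPX hP habove hrule
  obtain ⟨E, hE, hEcard, hrule⟩ := hrule
  have h := hA U hU hUneg hUcard ν hν ρ hρ X P hX hPX hP habove
  -- the summand, ball by ball
  set f : EuclideanSpace ℝ (Fin 3) → ℝ := fun q =>
    (((P.filter fun p => dist q p = 1 ∧ ∀ d ∈ U, ⟪p - q, d⟫_ℝ ≤ Real.sqrt 3 / 2).card : ℝ)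
      + (((X \ P).filter fun x => dist q x = 1 ∧ (∀ d ∈ U, ⟪x - q, d⟫_ℝ ≤ Real.sqrt 3 / 2) ∧
          ⟪x, ν⟫_ℝ < ⟪q, ν⟫_ℝ).card : ℝ)
      + (1 / 2) * (((X \ P).filter fun x => dist q x = 1 ∧ (∀ d ∈ U, ⟪x - q, d⟫_ℝ ≤ Real.sqrt 3 / 2) ∧
          ⟪x, ν⟫_ℝ = ⟪q, ν⟫_ℝ).card : ℝ)
      - ((U.filter fun d => ⟪d, ν⟫_ℝ < 0 ∧
          ∀ x ∈ X, dist q x = 1 → ⟪x - q, d⟫_ℝ ≤ Real.sqrt 3 / 2).card : ℝ)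
      - (1 / 2) * ((U.filter fun d => ⟪d, ν⟫_ℝ = 0 ∧
          ∀ x ∈ X, dist q x = 1 → ⟪x - q, d⟫_ℝ ≤ Real.sqrt 3 / 2).card : ℝ))
    with hf
  -- off the rim set the summand is `≤ 0`, on it `≤ 12`
  have hoff : ∀ q ∈ (X \ P) \ E, f q ≤ 0 := fun q hq => by
    have := hrule q hq; simp only [hf]; linarith
  have hon : ∀ q ∈ E, f q ≤ 12 := by
    intro q hq
    have h12 := card_partners_le_twelve X hX q
    have hsplit := card_partners_eq_plug_add_film X P hPX q
    have h1 : (P.filter fun p => dist q p = 1 ∧ ∀ d ∈ U, ⟪p - q, d⟫_ℝ ≤ Real.sqrt 3 / 2).card ≤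
        (P.filter fun p => dist q p = 1).card := card_le_card (fun p hp => by
      rw [mem_filter] at hp ⊢; exact ⟨hp.1, hp.2.1⟩)
    have h23 : ((X \ P).filter fun x => dist q x = 1 ∧ (∀ d ∈ U, ⟪x - q, d⟫_ℝ ≤ Real.sqrt 3 / 2) ∧
          ⟪x, ν⟫_ℝ < ⟪q, ν⟫_ℝ).card +
        ((X \ P).filter fun x => dist q x = 1 ∧ (∀ d ∈ U, ⟪x - q, d⟫_ℝ ≤ Real.sqrt 3 / 2) ∧
          ⟪x, ν⟫_ℝ = ⟪q, ν⟫_ℝ).card ≤ ((X \ P).filter fun x => dist q x = 1).card := by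
      rw [← card_union_of_disjoint]
      · refine card_le_card fun x hx => ?_
        rw [mem_union, mem_filter, mem_filter] at hx
        rw [mem_filter]
        rcases hx with hx | hx
        · exact ⟨hx.1, hx.2.1⟩
        · exact ⟨hx.1, hx.2.1⟩
      · exact disjoint_filter.2 fun x _ h1 h2 => absurd h2.2.2 h1.2.2.ne
    have e1 : ((P.filter fun p => dist q p = 1 ∧ ∀ d ∈ U, ⟪p - q, d⟫_ℝ ≤ Real.sqrt 3 / 2).card : ℝ) ≤
        (P.filter fun p => dist q p = 1).card := by exact_mod_cast h1
    have e23 : (((X \ P).filter fun x => dist q x = 1 ∧ (∀ d ∈ U, ⟪x - q, d⟫_ℝ ≤ Real.sqrt 3 / 2) ∧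
          ⟪x, ν⟫_ℝ < ⟪q, ν⟫_ℝ).card : ℝ) +
        (((X \ P).filter fun x => dist q x = 1 ∧ (∀ d ∈ U, ⟪x - q, d⟫_ℝ ≤ Real.sqrt 3 / 2) ∧
          ⟪x, ν⟫_ℝ = ⟪q, ν⟫_ℝ).card : ℝ) ≤ ((X \ P).filter fun x => dist q x = 1).card := by exact_mod_cast h23
    have e4 : ((P.filter fun p => dist q p = 1).card : ℝ) + ((X \ P).filter fun x => dist q x = 1).card ≤ 12 := by
      have : ((X.filter fun x => dist q x = 1).card : ℝ) ≤ 12 := by exact_mod_cast h12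
      have hs : ((X.filter fun x => dist q x = 1).card : ℝ) =
          (P.filter fun p => dist q p = 1).card + ((X \ P).filter fun x => dist q x = 1).card := by
        exact_mod_cast hsplit
      linarith
    simp only [hf]
    nlinarith [e1, e23, e4,
      Nat.cast_nonneg (α := ℝ) ((U.filter fun d => ⟪d, ν⟫_ℝ < 0 ∧
        ∀ x ∈ X, dist q x = 1 → ⟪x - q, d⟫_ℝ ≤ Real.sqrt 3 / 2).card),
      Nat.cast_nonneg (α := ℝ) ((U.filter fun d => ⟪d, ν⟫_ℝ = 0 ∧
        ∀ x ∈ X, dist q x = 1 → ⟪x - q, d⟫_ℝ ≤ Real.sqrt 3 / 2).card),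
      Nat.cast_nonneg (α := ℝ) (((X \ P).filter fun x => dist q x = 1 ∧
        (∀ d ∈ U, ⟪x - q, d⟫_ℝ ≤ Real.sqrt 3 / 2) ∧ ⟪x, ν⟫_ℝ = ⟪q, ν⟫_ℝ).card)]
  have hsum : ∑ q ∈ X \ P, f q ≤ 12 * ρ := by
    rw [← sum_sdiff hE]
    have h1 : ∑ q ∈ (X \ P) \ E, f q ≤ 0 := sum_nonpos hoff
    have h2 : ∑ q ∈ E, f q ≤ ∑ q ∈ E, (12 : ℝ) := sum_le_sum hon
    rw [sum_const, nsmul_eq_mul] at h2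
    nlinarith
  have hf' : ∑ q ∈ X \ P, f q = ∑ q ∈ X \ P,
      (((P.filter fun p => dist q p = 1 ∧ ∀ d ∈ U, ⟪p - q, d⟫_ℝ ≤ Real.sqrt 3 / 2).card : ℝ)
        + (((X \ P).filter fun x => dist q x = 1 ∧ (∀ d ∈ U, ⟪x - q, d⟫_ℝ ≤ Real.sqrt 3 / 2) ∧
            ⟪x, ν⟫_ℝ < ⟪q, ν⟫_ℝ).card : ℝ)
        + (1 / 2) * (((X \ P).filter fun x => dist q x = 1 ∧ (∀ d ∈ U, ⟪x - q, d⟫_ℝ ≤ Real.sqrt 3 / 2) ∧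
            ⟪x, ν⟫_ℝ = ⟪q, ν⟫_ℝ).card : ℝ)
        - ((U.filter fun d => ⟪d, ν⟫_ℝ < 0 ∧
            ∀ x ∈ X, dist q x = 1 → ⟪x - q, d⟫_ℝ ≤ Real.sqrt 3 / 2).card : ℝ)
        - (1 / 2) * ((U.filter fun d => ⟪d, ν⟫_ℝ = 0 ∧
            ∀ x ∈ X, dist q x = 1 → ⟪x - q, d⟫_ℝ ≤ Real.sqrt 3 / 2).card : ℝ)) := rfl
  rw [hf'] at hsum
  linarith

/-- **Bond-orientationally registered films satisfy the atom** (`R = 2`, `C = 768`; registered by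
name on stmt-Ventures-19144): if every contact of every film ball lies within `30°` of a unit vector
of the substrate lattice `Λ₀`, then `#cross(P, X∖P) ≤ D(X∖P) + C ρ` — every normal, arbitrary
positions and coordinations. -/
theorem registeredFilm_slab :
    ∃ R C : ℝ, 1 ≤ R ∧ ∀ ν : EuclideanSpace ℝ (Fin 3), ‖ν‖ = 1 → ∀ ρ : ℝ, R ≤ ρ →
      ∀ X P : Finset (EuclideanSpace ℝ (Fin 3)),
      (∀ p ∈ X, ∀ q ∈ X, p ≠ q → 1 ≤ dist p q) → P ⊆ X →
      (∀ p, p ∈ P ↔ (p ∈ fccStacking 1 (Real.sqrt (2 / 3)) ∧ -(2 * R) ≤ ⟪p, ν⟫_ℝ ∧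
        ⟪p, ν⟫_ℝ ≤ -R ∧ ‖p‖ ^ 2 - ⟪p, ν⟫_ℝ ^ 2 ≤ ρ ^ 2)) →
      (∀ q ∈ X \ P, -R < ⟪q, ν⟫_ℝ) →
      (∀ q ∈ X \ P, ∀ x ∈ X, dist q x = 1 →
        ∃ d ∈ fccStacking 1 (Real.sqrt (2 / 3)), ‖d‖ = 1 ∧ Real.sqrt 3 / 2 < ⟪x - q, d⟫_ℝ) →
      ((((P ×ˢ (X \ P)).filter fun pq => dist pq.1 pq.2 = 1).card : ℕ) : ℝ) ≤
        contactDeficiency (X \ P) + C * ρ := by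
  classical
  obtain ⟨R, C, hR, hA⟩ := interstitialGain_slab
  refine ⟨R, C, hR, ?_⟩
  intro ν hν ρ hρ X P hX hPX hP habove hreg
  -- the explicit bond star
  set U : Finset (EuclideanSpace ℝ (Fin 3)) :=
    ([barlowPos 1 (Real.sqrt (2 / 3)) constHagg 0 1 0, -barlowPos 1 (Real.sqrt (2 / 3)) constHagg 0 1 0,
        barlowPos 1 (Real.sqrt (2 / 3)) constHagg 0 0 1, -barlowPos 1 (Real.sqrt (2 / 3)) constHagg 0 0 1,
        barlowPos 1 (Real.sqrt (2 / 3)) constHagg 0 1 (-1), -barlowPos 1 (Real.sqrt (2 / 3)) constHagg 0 1 (-1),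
        barlowPos 1 (Real.sqrt (2 / 3)) constHagg 1 0 0, -barlowPos 1 (Real.sqrt (2 / 3)) constHagg 1 0 0,
        barlowPos 1 (Real.sqrt (2 / 3)) constHagg (-1) 1 0, -barlowPos 1 (Real.sqrt (2 / 3)) constHagg (-1) 1 0,
        barlowPos 1 (Real.sqrt (2 / 3)) constHagg (-1) 0 1, -barlowPos 1 (Real.sqrt (2 / 3)) constHagg (-1) 0 1] :
        List (EuclideanSpace ℝ (Fin 3))).toFinset with hUdef
  have hU : ∀ d ∈ U, d ∈ fccStacking 1 (Real.sqrt (2 / 3)) ∧ ‖d‖ = 1 := fun d hd => fccBondStar_mem hd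
  have hUneg : ∀ d ∈ U, -d ∈ U := fun d hd => fccBondStar_neg_mem hd
  have hUcard : U.card = 12 := fccBondStar_card
  have h := hA U hU hUneg hUcard ν hν ρ hρ X P hX hPX hP habove
  -- every contact of a film ball is registered to a member of `U`: the interstitial counts vanish
  have hnoint : ∀ q ∈ X \ P, ∀ x ∈ X, dist q x = 1 → ¬ ∀ d ∈ U, ⟪x - q, d⟫_ℝ ≤ Real.sqrt 3 / 2 := by
    intro q hq x hx hqx hall
    obtain ⟨d, hdΛ, hdn, hdx⟩ := hreg q hq x hx hqx
    have hdU : d ∈ U := fcc_unit_mem_of_bondStar U hU hUcard hdΛ hdn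
    exact absurd (hall d hdU) (not_le.2 hdx)
  have hz1 : ∀ q ∈ X \ P,
      (P.filter fun p => dist q p = 1 ∧ ∀ d ∈ U, ⟪p - q, d⟫_ℝ ≤ Real.sqrt 3 / 2).card = 0 := by
    intro q hq
    rw [card_eq_zero, filter_eq_empty_iff]
    exact fun p hp h => hnoint q hq p (hPX hp) h.1 h.2
  have hz2 : ∀ q ∈ X \ P,
      ((X \ P).filter fun x => dist q x = 1 ∧ (∀ d ∈ U, ⟪x - q, d⟫_ℝ ≤ Real.sqrt 3 / 2) ∧
        ⟪x, ν⟫_ℝ < ⟪q, ν⟫_ℝ).card = 0 := by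
    intro q hq
    rw [card_eq_zero, filter_eq_empty_iff]
    exact fun x hx h => hnoint q hq x (mem_sdiff.1 hx).1 h.1 h.2.1
  have hz3 : ∀ q ∈ X \ P,
      ((X \ P).filter fun x => dist q x = 1 ∧ (∀ d ∈ U, ⟪x - q, d⟫_ℝ ≤ Real.sqrt 3 / 2) ∧
        ⟪x, ν⟫_ℝ = ⟪q, ν⟫_ℝ).card = 0 := by
    intro q hq
    rw [card_eq_zero, filter_eq_empty_iff]
    exact fun x hx h => hnoint q hq x (mem_sdiff.1 hx).1 h.1 h.2.1
  have hsum : ∑ q ∈ X \ P,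
      (((P.filter fun p => dist q p = 1 ∧ ∀ d ∈ U, ⟪p - q, d⟫_ℝ ≤ Real.sqrt 3 / 2).card : ℝ)
        + (((X \ P).filter fun x => dist q x = 1 ∧ (∀ d ∈ U, ⟪x - q, d⟫_ℝ ≤ Real.sqrt 3 / 2) ∧
            ⟪x, ν⟫_ℝ < ⟪q, ν⟫_ℝ).card : ℝ)
        + (1 / 2) * (((X \ P).filter fun x => dist q x = 1 ∧ (∀ d ∈ U, ⟪x - q, d⟫_ℝ ≤ Real.sqrt 3 / 2) ∧
            ⟪x, ν⟫_ℝ = ⟪q, ν⟫_ℝ).card : ℝ)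
        - ((U.filter fun d => ⟪d, ν⟫_ℝ < 0 ∧
            ∀ x ∈ X, dist q x = 1 → ⟪x - q, d⟫_ℝ ≤ Real.sqrt 3 / 2).card : ℝ)
        - (1 / 2) * ((U.filter fun d => ⟪d, ν⟫_ℝ = 0 ∧
            ∀ x ∈ X, dist q x = 1 → ⟪x - q, d⟫_ℝ ≤ Real.sqrt 3 / 2).card : ℝ)) ≤ 0 := by
    refine sum_nonpos fun q hq => ?_
    rw [hz1 q hq, hz2 q hq, hz3 q hq]
    simp only [Nat.cast_zero, mul_zero, zero_add]
    linarith [Nat.cast_nonneg (α := ℝ) ((U.filter fun d => ⟪d, ν⟫_ℝ < 0 ∧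
        ∀ x ∈ X, dist q x = 1 → ⟪x - q, d⟫_ℝ ≤ Real.sqrt 3 / 2).card),
      Nat.cast_nonneg (α := ℝ) ((U.filter fun d => ⟪d, ν⟫_ℝ = 0 ∧
        ∀ x ∈ X, dist q x = 1 → ⟪x - q, d⟫_ℝ ≤ Real.sqrt 3 / 2).card)]
  linarith

end Summit.Ventures.Crystal3D.Theorems

end
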